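import Summits.CriticalPhenomena.PercolationContinuityZ3.Theses.PercDivergentSlabLadder
import Summits.CriticalPhenomena.PercolationContinuityZ3.Theorems.PercNearOneGluingNoHeavyLowerTailCSHTheoremOne
import Literature.Probability.Percolation.SubgraphMonotonicity
import Literature.Probability.Percolation.ConnectivityProofs
import HarnessLib

/-!
# `PercDivergentSlabLadder.ConeRung` (stmt-CriticalPhenomena-6701) — SETTLED after continuity

Item `stmt-CriticalPhenomena-6701` of route `CriticalPhenomena/PercDivergentSlabLadder` (crux): the cone rung — at `p_c(ℤ³)`, `θ = 0` at every vertex of the induced graph of every cone complement `V_m = {|x₀| ≤ m·max(|x₁|,|x₂|)}`.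

`θ` of an induced subgraph is at most `θ` of `ℤ³` at the same vertex (`theta_induce_le_holds`), which equals `θ_0(p_c) = 0` by translation invariance (`theta_zdGraph_eq_theta_zero`) and p205010; `θ ≥ 0` closes.  Adapted from the refuter's costume `Cruxes/ConeRung/Costume.lean` (`coneRung_of_summit`), whose summit hypothesis is now discharged.

builds on p205010 (kernel theorem, internal audit signed; external expert review pending) — USED (`CSH.percolationContinuityZ3_holds`).  RSW3 lane, lead gen 28 (prover-prim-rsw3-lead-g28-0):
'after continuity — the ledger harvest'.
References: G. Kozma, N. Nitzan (2024), Thm. 6 / Conj. 3 [KozmaNitzan2024]; G. Grimmett, *Percolation* (1999), §8 [GrimmettPercolation1999].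
-/

noncomputable section

namespace Summit.CriticalPhenomena.PercolationContinuityZ3.Theorems

namespace PercDivergentSlabLadderConeRung

open MeasureTheory Literature.Probability.Percolation Literature.Probability.LatticeModels

/-- **`PercDivergentSlabLadder.ConeRung` (stmt-CriticalPhenomena-6701), settled.**  `θ_{V_m}(x, p_c) ≤ θ_{ℤ³}(x, p_c) = θ_{ℤ³}(0, p_c) = 0`.
[cite: KozmaNitzan2024, Thm. 6 with Conj. 3 (p. 15)] -/
theorem coneRung_proof : Summit.CriticalPhenomena.PercolationContinuityZ3.Theses.PercDivergentSlabLadder.ConeRung := by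
  intro m x
  have h0 : theta (zdGraph 3) (0 : Site 3) (criticalProbI 3) = 0 := CSH.percolationContinuityZ3_holds
  have h1 := theta_induce_le_holds (zdGraph 3) {z : Site 3 | |z 0| ≤ (m : ℤ) * max |z 1| |z 2|} (x : Site 3) x.2 (criticalProbI 3)
  rw [theta_zdGraph_eq_theta_zero, h0] at h1
  exact le_antisymm h1 (by unfold theta; exact measureReal_nonneg)

end PercDivergentSlabLadderConeRung

end Summit.CriticalPhenomena.PercolationContinuityZ3.Theorems

end
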